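import Summits.AnomalousDissipation.AnomalousDissipation.Theorems.SawtoothPulseCascadeK1LocalisedCascadeSlotCascade

/-!
# K1loc, line `Spectral` — S-D (first good piece): THE VISCOUS–INVISCID COUPLING ON A SHEAR SLOT

Helper file of the prover lane on the crux `K1LocalisedCascade` (stmt-AnomalousDissipation-19491), route
`SawtoothPulseCascade`, registered line `Cruxes.K1LocalisedCascade.Spectral` (one open stub `stub_highModeConcentration`).
The energy ledger `…K1Ledger.highModeConcentration_of_ledger_threshold` needs a START bound `hstart` for the VISCOUS
classical cascade scalar `w` at the phase boundary `tStart i₀`, uniformly in `0 < κ ≤ κ₁`.  The analytic first good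
piece (memo v7 §5 / memo v8) computes that bound for ONE explicit function, the inviscid iterate `a_{i₀}` of the datum;
this file supplies the coupling between the two: on a half-slot `[t₀, t₁]` on which the velocity is a single shear
`u(t) = ρ(t) φ(x_j) eᵢ` (`ShearStage.drift`), with accumulated shear `Γ` (`Γ' = ρ`, `Γ(t₀) = 0`, `Γ(t₁) = c`) and
Lagrangian map `Φ_c : x ↦ x + c φ(x_j) eᵢ`, every smooth test function `a` satisfies

  `∫ (a ∘ Φ_c⁻¹) · w(t₁) ≥ ∫ a · w(t₀) − A · √(κ (t₁ − t₀)) · √(κ ∫_{t₀}^{t₁} ‖∇w‖²)`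

(`integral_comp_shear_mul_ge`), where `A² ≥ ∫ (∂ᵢa)² + (∂ⱼa − Γ(t) φ'(x_j) ∂ᵢa)²` for all `t` in the slot (the
enstrophy of the transported test function `a ∘ Φ_{Γ(t)}⁻¹`).  Proof: the pull-back `G(t) = w(t) ∘ Φ_{Γ(t)}` solves
`∂ₜG = κ (Δw)∘Φ` (`…K1Slot.timeDerivWithin_moved_eq_laplacian`), so `d/dt ∫ a G = κ ∫ a (Δw)∘Φ = −κ ∫ (∂ᵢa ∂ᵢG + D̄a D̄G)`
(pulled-back Green identity `…K1Slot.integral_mul_laplacian_comp_shear`), which is `≥ −κ A ‖∇w(t)‖` by Cauchy–Schwarz and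
`…K1Slot.scalarGradNormSq_eq_pullback`; integrate in time (FTC) and use Cauchy–Schwarz in time
(`…K1Slot.sq_intervalIntegral_le`).  Since `a ∘ Φ_c⁻¹` is the inviscid transport of `a` and `κ∫‖∇w‖² ≤ ‖w(t₀)‖²/2`
(energy identity), telescoping over the `2 i₀` half-slots gives `‖w(tStart i₀) − a_{i₀}‖² = O(√κ)` with an explicit
constant (companion file `…StartTransfer`).  §3 instantiates the slot bound on the H and V half-slots of the cascade
(`…K1Slot.field_eq_drift_of_mem_H/V`, strain clock `∫ rateH = γ`), also for the stub's class of classical scalars on `[0,1)`.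

WHAT THIS IS NOT: no statement about the stub itself and no smallness claim on `δ₀`; this is the `κ → 0` half of the
first good piece, valid for every `CascadeParams` with `γ ≥ 0`, `δ_j > 0`.
[cite: BedrossianCotiZelati2017, §2 (energy method in shear coordinates)] [cite: DEIJ2022, (1.2)–(1.3) (energy identity)]
[problem: turb]
-/

-- `Summit.<Summit>.<Problem>`: single-conjunct summit, the duplicate namespace segment is deliberate.
set_option linter.dupNamespace false

noncomputable section

namespace Summit.AnomalousDissipation.AnomalousDissipation.Theorems.SawtoothPulseCascade.K1Start

open MeasureTheory Set Filter Topology UnitAddTorus Function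
open scoped ContDiff InnerProductSpace
open Literature.Analysis Literature.Analysis.FunctionSpaces Literature.Analysis.FunctionSpaces.Torus
open Literature.Analysis.FluidPDE.ShearStage
open Summit.AnomalousDissipation.AnomalousDissipation.Theorems.SawtoothPulseCascade.K1Slot

/-! ## §1 A real-number fact -/

/-- `κ √(τ I) = √(κ τ) √(κ I)` for `κ, τ ≥ 0`. [folklore] -/
theorem mul_sqrt_mul_eq_sqrt_mul_sqrt {κ τ : ℝ} (hκ : 0 ≤ κ) (hτ : 0 ≤ τ) (I : ℝ) :
    κ * Real.sqrt (τ * I) = Real.sqrt (κ * τ) * Real.sqrt (κ * I) := by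
  rw [← Real.sqrt_mul (by positivity), show κ * τ * (κ * I) = κ ^ 2 * (τ * I) by ring,
    Real.sqrt_mul (sq_nonneg κ), Real.sqrt_sq hκ]

/-! ## §2 One shear slot: the pairing with a fixed test function along the pull-back -/

section Slot

variable {i j : Fin 2}

/-- **Pairing deficit over one shear slot, pull-back form.**  Let `θ` be a classical solution of
`∂ₜθ + u·∇θ = κΔθ` on `[t₀, t₁] × 𝕋²` (`t₀ < t₁`, `κ ≥ 0`) with the shear velocity `u(t) = ShearStage.drift i j φ (ρ t)`
(`i ≠ j`), `Γ` smooth on `[t₀, t₁]` with `Γ' = ρ` there, `G(t) = θ(t) ∘ Φ_{Γ(t)}` the pull-back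
(`ShearStage.moved θ i j φ (−Γ)`), `Q = φ'`, and `a` a smooth test function whose transported enstrophy is bounded on the
slot: `∫ (∂ᵢa)² + ∫ (∂ⱼa − Γ(t) Q(x_j) ∂ᵢa)² ≤ A²` (`A ≥ 0`).  Then
`∫ a · G(t₁) ≥ ∫ a · G(t₀) − A · √(κ (t₁ − t₀)) · √(scalarDissipation κ θ t₀ t₁)`.
[cite: BedrossianCotiZelati2017, §2 (energy method in shear coordinates)] [cite: DEIJ2022, (1.2)–(1.3)] -/
theorem integral_mul_moved_ge (hij : i ≠ j) (P Q : ShearProfile) (hQ : ∀ y, Q y = deriv P y)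
    {Γ ρ : ℝ → ℝ} {t₀ t₁ κ A : ℝ} (ht : t₀ < t₁) (hκ : 0 ≤ κ) (hA : 0 ≤ A)
    {u : ℝ → UnitAddTorus (Fin 2) → EuclideanSpace ℝ (Fin 2)} {θ : ℝ → UnitAddTorus (Fin 2) → ℝ}
    (hθ : FluidPDE.Torus.IsClassicalScalarTransportOn (Icc t₀ t₁) κ u θ)
    (hu : ∀ t ∈ Icc t₀ t₁, u t = drift i j P (ρ t)) (hΓs : ContDiffOn ℝ ∞ Γ (Icc t₀ t₁))
    (hΓ : ∀ t ∈ Icc t₀ t₁, HasDerivWithinAt Γ (ρ t) (Icc t₀ t₁) t)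
    {a : UnitAddTorus (Fin 2) → ℝ} (ha : IsSmooth a)
    (hAa : ∀ t ∈ Icc t₀ t₁, (∫ x, partialDeriv i a x ^ 2) +
        ∫ x, (partialDeriv j a x - Γ t * Q.onCircle (x j) * partialDeriv i a x) ^ 2 ≤ A ^ 2) :
    (∫ x, a x * moved θ i j P (-Γ) t₀ x) -
        A * Real.sqrt (κ * (t₁ - t₀)) * Real.sqrt (FluidPDE.Torus.scalarDissipation κ θ t₀ t₁) ≤
      ∫ x, a x * moved θ i j P (-Γ) t₁ x := by
  have hS : Convex ℝ (Icc t₀ t₁) := convex_Icc t₀ t₁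
  have hU : UniqueDiffOn ℝ (Icc t₀ t₁) := uniqueDiffOn_Icc ht
  have hGs : IsSmoothSpaceTimeOn (Icc t₀ t₁) (moved θ i j P (-Γ)) :=
    isSmoothSpaceTimeOn_moved_of_contDiffOn i j P hΓs hθ.smooth_scalar
  -- the pairing `p(t) = ∫ a · G(t)` and its one-sided derivative `D(t)`
  set φ : ℝ → UnitAddTorus (Fin 2) → ℝ := fun t x => a x * moved θ i j P (-Γ) t x with hφ_def
  have hφs : IsSmoothSpaceTimeOn (Icc t₀ t₁) φ := (isSmoothSpaceTimeOn_const ha _).mul hGs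
  set p : ℝ → ℝ := fun t => ∫ x, φ t x with hp_def
  set D : ℝ → ℝ := fun t => ∫ x, timeDerivWithin (Icc t₀ t₁) φ t x with hD_def
  have hp : ∀ t ∈ Icc t₀ t₁, HasDerivWithinAt p (D t) (Icc t₀ t₁) t := fun t ht' =>
    hφs.hasDerivWithinAt_integral hS ht'
  have hDc : ContinuousOn D (Icc t₀ t₁) := (hφs.timeDerivWithin hU).continuousOn_integral hS
  -- the value of the derivative: `D(t) = -κ ∫ (∂ᵢa ∂ᵢG + D̄a D̄G)`
  have hDval : ∀ t ∈ Icc t₀ t₁, D t = -(κ * ((∫ x, partialDeriv i a x * partialDeriv i (moved θ i j P (-Γ) t) x) +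
      ∫ x, (partialDeriv j a x - Γ t * Q.onCircle (x j) * partialDeriv i a x) *
        (partialDeriv j (moved θ i j P (-Γ) t) x -
          Γ t * Q.onCircle (x j) * partialDeriv i (moved θ i j P (-Γ) t) x))) := by
    intro t ht'
    have hθt : IsSmooth (θ t) := hθ.smooth_scalar.isSmooth_slice ht'
    have hGt : IsSmooth (moved θ i j P (-Γ) t) := by
      rw [moved_neg_apply]; exact hθt.comp_shearMap i j _
    have hpt : (fun x => timeDerivWithin (Icc t₀ t₁) φ t x) =
        fun x => κ * (a x * laplacian (θ t) (shearMap i j (amp P (-Γ t)) x)) := by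
      funext x
      have h1 : HasDerivWithinAt (fun τ => a x * moved θ i j P (-Γ) τ x)
          (a x * timeDerivWithin (Icc t₀ t₁) (moved θ i j P (-Γ)) t x) (Icc t₀ t₁) t :=
        (hGs.hasDerivWithinAt_slice ht' x).const_mul (a x)
      rw [show timeDerivWithin (Icc t₀ t₁) φ t x = derivWithin (fun τ => a x * moved θ i j P (-Γ) τ x) (Icc t₀ t₁) t
          from rfl, h1.derivWithin (hU t ht'), timeDerivWithin_moved_eq_laplacian hU hij P hθ hu ht' (hΓ t ht') x,
        moved_apply, Pi.neg_apply]
      ring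
    have hf₁ : IsSmooth (partialDeriv i a) := ha.partialDeriv i
    have hg₁ : IsSmooth (partialDeriv i (moved θ i j P (-Γ) t)) := hGt.partialDeriv i
    have hf₂ := isSmooth_slotDeriv (i := i) (j := j) Q (Γ t) ha
    have hg₂ := isSmooth_slotDeriv (i := i) (j := j) Q (Γ t) hGt
    have hi₁ : IsSmooth (fun x => partialDeriv i a x * partialDeriv i (moved θ i j P (-Γ) t) x) := hf₁.mul hg₁
    have hi₂ : IsSmooth (fun x => (partialDeriv j a x - Γ t * Q.onCircle (x j) * partialDeriv i a x) *
        (partialDeriv j (moved θ i j P (-Γ) t) x -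
          Γ t * Q.onCircle (x j) * partialDeriv i (moved θ i j P (-Γ) t) x)) := hf₂.mul hg₂
    rw [hD_def]
    dsimp only
    rw [hpt, integral_const_mul, integral_mul_laplacian_comp_shear hij P (Γ t) ha hθt, ← moved_neg_apply θ P Γ t]
    simp_rw [partialDeriv_onCircle_comp_eq P Q hQ]
    rw [integral_add hi₁.integrable hi₂.integrable, mul_neg]
  -- lower bound of the derivative: `D(t) ≥ -κ A ‖∇θ(t)‖`
  have hDge : ∀ t ∈ Icc t₀ t₁, -(κ * A * Real.sqrt (FluidPDE.Torus.scalarGradNormSq (θ t))) ≤ D t := by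
    intro t ht'
    have hθt : IsSmooth (θ t) := hθ.smooth_scalar.isSmooth_slice ht'
    have hGt : IsSmooth (moved θ i j P (-Γ) t) := by
      rw [moved_neg_apply]; exact hθt.comp_shearMap i j _
    have hf₁ : IsSmooth (partialDeriv i a) := ha.partialDeriv i
    have hg₁ : IsSmooth (partialDeriv i (moved θ i j P (-Γ) t)) := hGt.partialDeriv i
    have hf₂ := isSmooth_slotDeriv (i := i) (j := j) Q (Γ t) ha
    have hg₂ := isSmooth_slotDeriv (i := i) (j := j) Q (Γ t) hGt
    have hCS₁ := (le_abs_self _).trans (abs_integral_mul_le hf₁ hg₁)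
    have hCS₂ := (le_abs_self _).trans (abs_integral_mul_le hf₂ hg₂)
    have hgrad := scalarGradNormSq_eq_pullback hij P Q hQ Γ (θ := θ) (t := t) hθt
    have h0a₁ : 0 ≤ ∫ x, partialDeriv i a x ^ 2 := integral_nonneg fun x => sq_nonneg _
    have h0a₂ : 0 ≤ ∫ x, (partialDeriv j a x - Γ t * Q.onCircle (x j) * partialDeriv i a x) ^ 2 :=
      integral_nonneg fun x => sq_nonneg _
    have h0g₁ : 0 ≤ ∫ x, partialDeriv i (moved θ i j P (-Γ) t) x ^ 2 := integral_nonneg fun x => sq_nonneg _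
    have h0g₂ : 0 ≤ ∫ x, (partialDeriv j (moved θ i j P (-Γ) t) x -
        Γ t * Q.onCircle (x j) * partialDeriv i (moved θ i j P (-Γ) t) x) ^ 2 :=
      integral_nonneg fun x => sq_nonneg _
    have hle : (∫ x, partialDeriv i a x * partialDeriv i (moved θ i j P (-Γ) t) x) +
        ∫ x, (partialDeriv j a x - Γ t * Q.onCircle (x j) * partialDeriv i a x) *
          (partialDeriv j (moved θ i j P (-Γ) t) x -
            Γ t * Q.onCircle (x j) * partialDeriv i (moved θ i j P (-Γ) t) x) ≤
        A * Real.sqrt (FluidPDE.Torus.scalarGradNormSq (θ t)) := by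
      refine (add_le_add hCS₁ hCS₂).trans ?_
      -- Cauchy–Schwarz in `ℝ²` (the tree's `…Theorems.nonresonantSelection_alg_cauchySchwarz_two`, inlined)
      have hcs2 : ∀ x y z v : ℝ, x * y + z * v ≤ Real.sqrt (x ^ 2 + z ^ 2) * Real.sqrt (y ^ 2 + v ^ 2) := by
        intro x y z v
        rw [← Real.sqrt_mul (by positivity)]
        exact (le_abs_self _).trans (Real.abs_le_sqrt (by nlinarith [sq_nonneg (x * v - z * y)]))
      refine (hcs2 _ _ _ _).trans ?_
      rw [Real.sq_sqrt h0a₁, Real.sq_sqrt h0a₂, Real.sq_sqrt h0g₁, Real.sq_sqrt h0g₂, ← hgrad]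
      refine mul_le_mul_of_nonneg_right ?_ (Real.sqrt_nonneg _)
      exact (Real.sqrt_le_sqrt (hAa t ht')).trans_eq (Real.sqrt_sq hA)
    rw [hDval t ht']
    have := mul_le_mul_of_nonneg_left hle hκ
    nlinarith
  -- fundamental theorem of calculus and monotonicity of the time integral
  have hDi : IntervalIntegrable D volume t₀ t₁ := (hDc.mono (by rw [uIcc_of_le ht.le])).intervalIntegrable
  have hFTC : ∫ t in t₀..t₁, D t = p t₁ - p t₀ :=
    intervalIntegral.integral_eq_sub_of_hasDerivAt_of_le ht.le (fun t ht' => (hp t ht').continuousWithinAt)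
      (fun t ht' => (hp t (Ioo_subset_Icc_self ht')).hasDerivAt (Icc_mem_nhds ht'.1 ht'.2)) hDi
  set g : ℝ → ℝ := fun t => Real.sqrt (FluidPDE.Torus.scalarGradNormSq (θ t)) with hg_def
  have hgc : ContinuousOn g (Icc t₀ t₁) := (hθ.continuousOn_scalarGradNormSq hS hU).sqrt
  have hgi : IntervalIntegrable g volume t₀ t₁ := (hgc.mono (by rw [uIcc_of_le ht.le])).intervalIntegrable
  have hmono : ∫ t in t₀..t₁, -(κ * A * g t) ≤ ∫ t in t₀..t₁, D t :=
    intervalIntegral.integral_mono_on ht.le (hgi.const_mul (κ * A)).neg hDi fun t ht' => hDge t ht'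
  rw [intervalIntegral.integral_neg, intervalIntegral.integral_const_mul, hFTC] at hmono
  -- Cauchy–Schwarz in time: `∫ g ≤ √((t₁ - t₀) ∫ g²)`, `∫ g² = ∫ ‖∇θ‖²`
  have hg2 : ∫ t in t₀..t₁, g t ^ 2 = ∫ t in t₀..t₁, FluidPDE.Torus.scalarGradNormSq (θ t) :=
    intervalIntegral.integral_congr fun t _ => Real.sq_sqrt (FluidPDE.Torus.scalarGradNormSq_nonneg _)
  have hCS : ∫ t in t₀..t₁, g t ≤ Real.sqrt ((t₁ - t₀) * ∫ t in t₀..t₁, FluidPDE.Torus.scalarGradNormSq (θ t)) := by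
    have h := sq_intervalIntegral_le ht.le hgc
    rw [hg2] at h
    exact (le_abs_self _).trans (Real.abs_le_sqrt h)
  have hkey : κ * A * ∫ t in t₀..t₁, g t ≤
      A * Real.sqrt (κ * (t₁ - t₀)) * Real.sqrt (FluidPDE.Torus.scalarDissipation κ θ t₀ t₁) := by
    have h1 := mul_le_mul_of_nonneg_left hCS (mul_nonneg hκ hA)
    rw [show κ * A * Real.sqrt ((t₁ - t₀) * ∫ t in t₀..t₁, FluidPDE.Torus.scalarGradNormSq (θ t)) =
        A * (κ * Real.sqrt ((t₁ - t₀) * ∫ t in t₀..t₁, FluidPDE.Torus.scalarGradNormSq (θ t))) by ring,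
      mul_sqrt_mul_eq_sqrt_mul_sqrt hκ (by linarith) _, ← mul_assoc] at h1
    exact h1
  have hp0 : p t₀ = ∫ x, a x * moved θ i j P (-Γ) t₀ x := rfl
  have hp1 : p t₁ = ∫ x, a x * moved θ i j P (-Γ) t₁ x := rfl
  linarith

/-- **Pairing deficit over one shear slot, Eulerian form.**  Under the hypotheses of `integral_mul_moved_ge`, with
`Γ(t₀) = 0` and `Γ(t₁) = c`:  `∫ (a ∘ Φ_c⁻¹) · θ(t₁) ≥ ∫ a · θ(t₀) − A · √(κ (t₁ − t₀)) · √(scalarDissipation κ θ t₀ t₁)`,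
where `Φ_c⁻¹ = shearMap i j (c•φ) : x ↦ x − c φ(x_j) eᵢ`, so that `a ∘ Φ_c⁻¹` is the INVISCID transport of `a` across
the slot (`ShearStage.isClassicalScalarTransportOn_moved_static`).
[cite: BedrossianCotiZelati2017, §2 (energy method in shear coordinates)] [cite: DEIJ2022, (1.2)–(1.3)] -/
theorem integral_comp_shear_mul_ge (hij : i ≠ j) (P Q : ShearProfile) (hQ : ∀ y, Q y = deriv P y)
    {Γ ρ : ℝ → ℝ} {t₀ t₁ κ A : ℝ} (ht : t₀ < t₁) (hκ : 0 ≤ κ) (hA : 0 ≤ A)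
    {u : ℝ → UnitAddTorus (Fin 2) → EuclideanSpace ℝ (Fin 2)} {θ : ℝ → UnitAddTorus (Fin 2) → ℝ}
    (hθ : FluidPDE.Torus.IsClassicalScalarTransportOn (Icc t₀ t₁) κ u θ)
    (hu : ∀ t ∈ Icc t₀ t₁, u t = drift i j P (ρ t)) (hΓs : ContDiffOn ℝ ∞ Γ (Icc t₀ t₁))
    (hΓ : ∀ t ∈ Icc t₀ t₁, HasDerivWithinAt Γ (ρ t) (Icc t₀ t₁) t)
    {a : UnitAddTorus (Fin 2) → ℝ} (ha : IsSmooth a)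
    (hAa : ∀ t ∈ Icc t₀ t₁, (∫ x, partialDeriv i a x ^ 2) +
        ∫ x, (partialDeriv j a x - Γ t * Q.onCircle (x j) * partialDeriv i a x) ^ 2 ≤ A ^ 2)
    (hΓ0 : Γ t₀ = 0) {c : ℝ} (hΓ1 : Γ t₁ = c) :
    (∫ x, a x * θ t₀ x) - A * Real.sqrt (κ * (t₁ - t₀)) * Real.sqrt (FluidPDE.Torus.scalarDissipation κ θ t₀ t₁) ≤
      ∫ x, a (shearMap i j (amp P c) x) * θ t₁ x := by
  have h := integral_mul_moved_ge hij P Q hQ ht hκ hA hθ hu hΓs hΓ ha hAa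
  have e0 : (fun x => a x * moved θ i j P (-Γ) t₀ x) = fun x => a x * θ t₀ x := by
    funext x; rw [moved_apply, Pi.neg_apply, hΓ0, neg_zero, shearMap_amp_zero]
  have e1 : (fun x => a x * moved θ i j P (-Γ) t₁ x) = fun x => a x * θ t₁ (shearMap i j (amp P (-c)) x) := by
    funext x; rw [moved_apply, Pi.neg_apply, hΓ1]
  rw [e0, e1, integral_mul_comp_shear hij P c a (θ t₁)] at h
  exact h

end Slot

/-! ## §3 The H and V half-slots of the cascade -/

section Cascade

open Literature.Analysis.FluidPDE.SawtoothCascade Literature.Analysis.FluidPDE.SawtoothCascade.CascadeParams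

variable (P : CascadeParams)

/-- **Viscous–inviscid coupling on the H half-slot of phase `j`.**  For a classical solution `w` of
`∂ₜw + ū·∇w = κΔw` on `[tStart j, tStart j + tHalf j]` (`ū = CascadeParams.field`, `γ ≥ 0`, `δ_j > 0`, `κ ≥ 0`), a smooth
test function `a` with `∫ (∂₀a)² + ∫ (∂₁a − c U_j'(x₁) ∂₀a)² ≤ A²` for all `c ∈ [0, γ]` (`Q = U_j'`, `A ≥ 0`):
`∫ (a ∘ Φ_γ⁻¹) · w(tStart j + tHalf j) ≥ ∫ a · w(tStart j) − A √(κ · tHalf j) √(scalarDissipation κ w …)`,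
`Φ_γ⁻¹ = shearMap 0 1 (γ•U_j) : x ↦ x − γ U_j(x₁) e₀`.
[cite: BedrossianCotiZelati2017, §2] [cite: ElgindiLissMattingly2025, Rmk. 1.4 (∫φ = α per pulse)] -/
theorem integral_comp_shearH_mul_ge (hγ : 0 ≤ P.γ) {j : ℕ} (hδ : 0 < P.δ j) (Q : ShearProfile)
    (hQ : ∀ y, Q y = deriv (P.U j) y) {κ A : ℝ} (hκ : 0 ≤ κ) (hA : 0 ≤ A)
    {w : ℝ → UnitAddTorus (Fin 2) → ℝ}
    (hw : FluidPDE.Torus.IsClassicalScalarTransportOn (Icc (tStart j) (tStart j + tHalf j)) κ P.field w)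
    {a : UnitAddTorus (Fin 2) → ℝ} (ha : IsSmooth a)
    (hAa : ∀ c ∈ Icc 0 P.γ, (∫ x, partialDeriv (0 : Fin 2) a x ^ 2) +
        ∫ x, (partialDeriv (1 : Fin 2) a x - c * Q.onCircle (x 1) * partialDeriv (0 : Fin 2) a x) ^ 2 ≤ A ^ 2) :
    (∫ x, a x * w (tStart j) x) - A * Real.sqrt (κ * tHalf j) *
        Real.sqrt (FluidPDE.Torus.scalarDissipation κ w (tStart j) (tStart j + tHalf j)) ≤
      ∫ x, a (shearMap 0 1 (amp ⟨P.U j, P.U_periodic j, P.contDiff_U hδ⟩ P.γ) x) * w (tStart j + tHalf j) x := by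
  set U : ShearProfile := ⟨P.U j, P.U_periodic j, P.contDiff_U hδ⟩ with hU
  set Γ : ℝ → ℝ := fun t => ∫ s in tStart j..t, P.rateH j s with hΓ
  have ht : tStart j < tStart j + tHalf j := by linarith [tHalf_pos j]
  have hQ' : ∀ y, Q y = deriv U y := hQ
  have hmain := integral_comp_shear_mul_ge (i := 0) (j := 1) (by decide) U Q hQ' (Γ := Γ) (ρ := P.rateH j)
    ht hκ hA hw (fun t htI => field_eq_drift_of_mem_H P hδ htI) ((contDiff_strainH P j).contDiffOn)
    (fun t _ => (hasDerivAt_strainH P j t).hasDerivWithinAt) ha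
    (fun t htI => hAa (Γ t) (strainH_mem_Icc P hγ htI)) (by simp [hΓ]) (P.integral_rateH j)
  rwa [add_sub_cancel_left] at hmain

/-- **Viscous–inviscid coupling on the V half-slot of phase `j`** (indices swapped: the test-function hypothesis reads
`∫ (∂₁a)² + ∫ (∂₀a − c U_j'(x₀) ∂₁a)² ≤ A²`, the transport is `Φ_γ⁻¹ = shearMap 1 0 (γ•U_j)`, the slot is
`[tStart j + tHalf j, tStart (j+1)]`). [cite: BedrossianCotiZelati2017, §2] [cite: ElgindiLissMattingly2025, Rmk. 1.4] -/
theorem integral_comp_shearV_mul_ge (hγ : 0 ≤ P.γ) {j : ℕ} (hδ : 0 < P.δ j) (Q : ShearProfile)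
    (hQ : ∀ y, Q y = deriv (P.U j) y) {κ A : ℝ} (hκ : 0 ≤ κ) (hA : 0 ≤ A)
    {w : ℝ → UnitAddTorus (Fin 2) → ℝ}
    (hw : FluidPDE.Torus.IsClassicalScalarTransportOn (Icc (tStart j + tHalf j) (tStart (j + 1))) κ P.field w)
    {a : UnitAddTorus (Fin 2) → ℝ} (ha : IsSmooth a)
    (hAa : ∀ c ∈ Icc 0 P.γ, (∫ x, partialDeriv (1 : Fin 2) a x ^ 2) +
        ∫ x, (partialDeriv (0 : Fin 2) a x - c * Q.onCircle (x 0) * partialDeriv (1 : Fin 2) a x) ^ 2 ≤ A ^ 2) :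
    (∫ x, a x * w (tStart j + tHalf j) x) - A * Real.sqrt (κ * tHalf j) *
        Real.sqrt (FluidPDE.Torus.scalarDissipation κ w (tStart j + tHalf j) (tStart (j + 1))) ≤
      ∫ x, a (shearMap 1 0 (amp ⟨P.U j, P.U_periodic j, P.contDiff_U hδ⟩ P.γ) x) * w (tStart (j + 1)) x := by
  set U : ShearProfile := ⟨P.U j, P.U_periodic j, P.contDiff_U hδ⟩ with hU
  set Γ : ℝ → ℝ := fun t => ∫ s in (tStart j + tHalf j)..t, P.rateV j s with hΓ
  have ht : tStart j + tHalf j < tStart (j + 1) := by rw [tStart_succ]; linarith [tHalf_pos j]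
  have hτ : tStart (j + 1) - (tStart j + tHalf j) = tHalf j := by rw [tStart_succ]; ring
  have hQ' : ∀ y, Q y = deriv U y := hQ
  have hmain := integral_comp_shear_mul_ge (i := 1) (j := 0) (by decide) U Q hQ' (Γ := Γ) (ρ := P.rateV j)
    ht hκ hA hw (fun t htI => field_eq_drift_of_mem_V P hδ htI) ((contDiff_strainV P j).contDiffOn)
    (fun t _ => (hasDerivAt_strainV P j t).hasDerivWithinAt) ha
    (fun t htI => hAa (Γ t) (strainV_mem_Icc P hγ htI)) (by simp [hΓ]) (P.integral_rateV j)
  rwa [hτ] at hmain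

/-- **The H half-slot coupling for classical cascade scalars on `[0,1)`** (the stub's hypothesis class
`IsClassicalScalarTransportOn (Ico 0 1) κ P.field w`, `γ ≥ 0`, `δ₀ > 0`, `d > 0`): restriction to the closed H half-slot and
`integral_comp_shearH_mul_ge`. [cite: BedrossianCotiZelati2017, §2] -/
theorem integral_comp_shearH_mul_ge_of_Ico (hγ : 0 ≤ P.γ) (hδ₀ : 0 < P.δ₀) (hd : 0 < P.d) (j : ℕ)
    (Q : ShearProfile) (hQ : ∀ y, Q y = deriv (P.U j) y) {κ A : ℝ} (hκ : 0 ≤ κ) (hA : 0 ≤ A)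
    {w : ℝ → UnitAddTorus (Fin 2) → ℝ} (hw : FluidPDE.Torus.IsClassicalScalarTransportOn (Ico 0 1) κ P.field w)
    {a : UnitAddTorus (Fin 2) → ℝ} (ha : IsSmooth a)
    (hAa : ∀ c ∈ Icc 0 P.γ, (∫ x, partialDeriv (0 : Fin 2) a x ^ 2) +
        ∫ x, (partialDeriv (1 : Fin 2) a x - c * Q.onCircle (x 1) * partialDeriv (0 : Fin 2) a x) ^ 2 ≤ A ^ 2) :
    (∫ x, a x * w (tStart j) x) - A * Real.sqrt (κ * tHalf j) *
        Real.sqrt (FluidPDE.Torus.scalarDissipation κ w (tStart j) (tStart j + tHalf j)) ≤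
      ∫ x, a (shearMap 0 1 (amp ⟨P.U j, P.U_periodic j, P.contDiff_U (P.δ_pos hδ₀ hd j)⟩ P.γ) x) *
        w (tStart j + tHalf j) x :=
  integral_comp_shearH_mul_ge P hγ (P.δ_pos hδ₀ hd j) Q hQ hκ hA
    (hw.restrict_Icc (by linarith [tHalf_pos j]) (CascadeParams.Icc_H_subset_Ico j)) ha hAa

/-- **The V half-slot coupling for classical cascade scalars on `[0,1)`**. [cite: BedrossianCotiZelati2017, §2] -/
theorem integral_comp_shearV_mul_ge_of_Ico (hγ : 0 ≤ P.γ) (hδ₀ : 0 < P.δ₀) (hd : 0 < P.d) (j : ℕ)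
    (Q : ShearProfile) (hQ : ∀ y, Q y = deriv (P.U j) y) {κ A : ℝ} (hκ : 0 ≤ κ) (hA : 0 ≤ A)
    {w : ℝ → UnitAddTorus (Fin 2) → ℝ} (hw : FluidPDE.Torus.IsClassicalScalarTransportOn (Ico 0 1) κ P.field w)
    {a : UnitAddTorus (Fin 2) → ℝ} (ha : IsSmooth a)
    (hAa : ∀ c ∈ Icc 0 P.γ, (∫ x, partialDeriv (1 : Fin 2) a x ^ 2) +
        ∫ x, (partialDeriv (0 : Fin 2) a x - c * Q.onCircle (x 0) * partialDeriv (1 : Fin 2) a x) ^ 2 ≤ A ^ 2) :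
    (∫ x, a x * w (tStart j + tHalf j) x) - A * Real.sqrt (κ * tHalf j) *
        Real.sqrt (FluidPDE.Torus.scalarDissipation κ w (tStart j + tHalf j) (tStart (j + 1))) ≤
      ∫ x, a (shearMap 1 0 (amp ⟨P.U j, P.U_periodic j, P.contDiff_U (P.δ_pos hδ₀ hd j)⟩ P.γ) x) *
        w (tStart (j + 1)) x :=
  integral_comp_shearV_mul_ge P hγ (P.δ_pos hδ₀ hd j) Q hQ hκ hA
    (hw.restrict_Icc (by rw [tStart_succ]; linarith [tHalf_pos j]) (CascadeParams.Icc_V_subset_Ico j)) ha hAa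

end Cascade

end Summit.AnomalousDissipation.AnomalousDissipation.Theorems.SawtoothPulseCascade.K1Start
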